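import Mathlib
import HarnessLib
import Summits.HubbardSuperconductivity.HubbardSuperconductivity.Theorems.KLProgrammeKLRegimeSplitBundleV6
import Summits.HubbardSuperconductivity.HubbardSuperconductivity.Theorems.KLProgrammeKLRegimeSplitChildOneClosersS
import Summits.HubbardSuperconductivity.HubbardSuperconductivity.Theorems.KLProgrammeKLRegimeSplitChildOneClosers

/-!
# Route `KLProgramme`, crux K3 (stmt-HubbardSuperconductivity-19937), child 1 `KLRegimeBetaSplit` at the V6 bundle — the PER-SCALE STEP:
# `klPredsV6.split n` (= `BetaSplitAtS n`) from row 0′'s `PairArrayAt n`, the engine slot `klPredsV6.engine n` (= `EngineBoundsAtV4S n`) and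
# three arithmetic side conditions on the constants

Cell gate-hubbard-kl, seat p1b (g3; child-1 co-owner).  Composition of the landed pieces: (B1-v2) `PairArrayAt n` is row 0′'s output
(p3 / hubbard-kl-r2d-p1, from `PairLadderStepAtV4` over the history); (B2-S) `EndpointLineS n` ⇐ `PairArrayAt n ∧ IsoTupleL1AtS n` with the sharp
value bound `B = 2|U| + C_W U²` (p1 `endpointLineS_of`, `…ChildOneClosersS`); (B4) `FirstMoments n` ⇐ (E4) `EngineFirstMoments n` (p1
`firstMoments_of_engineFirstMoments`, `…ChildOneClosers`).  The side conditions are met by child 1's constant choices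
`P.Klam := 4·G.CF + 5` (or `2·G.CF + 1`), `P.Cd := G.cE4 + 1` and `U ≤ U₀(G, P, Q)` (HOME/p1/CHILD1-SKELETON.md §1; r2d-p1's skeleton).
So the child-1 item at V6 reduces to row 0′ + this lemma + the constants/threshold bookkeeping.  Nothing is asserted about the model.
-/

noncomputable section

namespace Summit.HubbardSuperconductivity.HubbardSuperconductivity.Theorems.KLRegimeSplit

set_option linter.dupNamespace false -- summit = problem name (single-conjunct summit), D-0017

open Literature.MathematicalPhysics.QuantumLattice Literature.Probability.LatticeModels

section Model

variable (L M : ℕ) [NeZero L] [NeZero M]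

/-- **The per-scale child-1 step at the S/V4S slots**: `PairArrayAt n` (row 0′) and `EngineBoundsAtV4S n` give `BetaSplitAtS n`, under the
arithmetic side conditions `CF·(2|U| + C_W U²) + CF·(Klam U)² ≤ Klam|U|`, `2|U| + C_W U² ≤ Klam|U|`, `cE4 + cE4′|U| ≤ Cd`. -/
theorem betaSplitAtS_of_engineV4S {G : GeoConsts} (P : SplitConsts) {Q : EngConsts} {β U μ : ℝ} {K : TrigPolyC4v} {n : ℕ}
    (hU : 0 ≤ 2 * |U| + P.C_W * U ^ 2) (hP : 0 ≤ P.Klam)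
    (hpair : PairArrayAt L M P β U μ K n) (hE : EngineBoundsAtV4S L M G P Q β U μ K n)
    (harith : G.CF * (2 * |U| + P.C_W * U ^ 2) + G.CF * (P.Klam * U) ^ 2 ≤ P.Klam * |U|)
    (hK : 2 * |U| + P.C_W * U ^ 2 ≤ P.Klam * |U|) (hCd : G.cE4 + Q.cE4 * |U| ≤ P.Cd) :
    BetaSplitAtS L M G P Q β U μ K n :=
  ⟨hpair, endpointLineS_of L M P hU hpair hE.2.2.2.2.2.2.2 harith hK,
    firstMoments_of_engineFirstMoments L M hP hCd hE.2.2.2.2.2.2.1⟩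

/-- **The same at the bundle's slots**: `klPredsV6.split … n` from `PairArrayAt n` and `klPredsV6.engine … n` (+ the side conditions). -/
theorem klPredsV6_split_of_pairArrayAt {G : GeoConsts} (P : SplitConsts) {Q : EngConsts} {β U μ : ℝ} {K : TrigPolyC4v} {n : ℕ}
    (hU : 0 ≤ 2 * |U| + P.C_W * U ^ 2) (hP : 0 ≤ P.Klam)
    (hpair : PairArrayAt L M P β U μ K n) (hE : klPredsV6.engine L M G P Q β U μ K n)
    (harith : G.CF * (2 * |U| + P.C_W * U ^ 2) + G.CF * (P.Klam * U) ^ 2 ≤ P.Klam * |U|)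
    (hK : 2 * |U| + P.C_W * U ^ 2 ≤ P.Klam * |U|) (hCd : G.cE4 + Q.cE4 * |U| ≤ P.Cd) :
    klPredsV6.split L M G P Q β U μ K n :=
  betaSplitAtS_of_engineV4S L M P hU hP hpair hE harith hK hCd

/-- What the history gives row 0′ at the V6 bundle: `HistP klPredsV6 … n` yields `EngineBoundsAtV4S … j` (hence `PairLadderStepAtV4 … j` and
`PairValueIncrementAtV4 … j`) and `BetaSplitAtS … j` (hence `PairArrayAt … j`) at every `j < n`. -/
theorem histP_klPredsV6_engine_split {G : GeoConsts} {P : SplitConsts} {Q : EngConsts} {R : RenConsts} {β U μ : ℝ} {K : TrigPolyC4v}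
    {n : ℕ} (h : HistP klPredsV6 L M G P Q R β U μ K n) {j : ℕ} (hj : j < n) :
    EngineBoundsAtV4S L M G P Q β U μ K j ∧ PairArrayAt L M P β U μ K j :=
  ⟨(h j hj).2.2.1, (h j hj).1.1⟩

end Model

end Summit.HubbardSuperconductivity.HubbardSuperconductivity.Theorems.KLRegimeSplit

end
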